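import Summits.QuantumFields.YangMills.Theorems.BalabanUVNodesN07ChartLogReality
import Summits.QuantumFields.YangMills.Theorems.BalabanUVNodesN07FarRowsOfTowerLetters
import Summits.QuantumFields.YangMills.Theorems.BalabanUVNodesN07NormalisationDbarFrames
import Summits.QuantumFields.YangMills.Theorems.UnitScaleTiltProp8ChartDiffLocal
import Literature.MathematicalPhysics.QuantumFieldTheory.Balaban1983to89.B12Lemma4Concrete
import Literature.MathematicalPhysics.QuantumFieldTheory.Balaban1983to89.Node00.Record12BgRowGaugeAxial
import HarnessLib

/-!
# N07 [B11] (= [15]) Sect. F — MODULE 95: **THE DICTIONARY FOR THE REPRESENTATIVE, FROM THE LANDAU COPY's READS** (step 3 of (c′)‴): dag-n07-w2's local dictionary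
# `Ū^{(i)}_{eml}(U♮) = (M^i U)♮` needs fine reads `‖U(b) − 1‖ ≤ s₀` under the two blocks of a bond; the K0 road has such reads for the LANDAU COPY `U^u` ONLY (S3's gauge equation
# `U^u = e^{iηA}` with the (152) letters, on the datum's tower) — but the identity is GAUGE COVARIANT, so it transfers to the representative `U″ = U^{h̄·w}` of MODULE 91″ bond by bond

Cell `pub-ymgap`, seat `pub-ymgap-dag-n07-e` g28 (FAN-OUT §N07 row s3; LANE OWNER of the K0 road chart side), MODULE 95 (INTENT-95, cell bus; plan (α⁗-W) step 3 of (c′)‴).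
`--kind proof --supports stmt-QuantumFields-20541 --as helper` (K0⁷); count-neutral; THEOREMS ONLY (0 `def`); generic `P`, `N ≥ 1`.
[I] = [Balaban1987RG1]; [3] = [Balaban1985Averaging]; [15] = [Balaban1985Variational]; [6] = [Balaban1985RegularSpaces]; [4] = [Balaban1984PropagatorsII].

WHY.  MODULE 94 reads `U̿^{(l)}(U^u)♮(c)` through the representative's `eml`-averages `Ū^{(l)}_{eml}((U^{gw})♮)` and needs, at `c` and inside the out-block, the dictionary identity
`Ū^{(l)}_{eml}((U^{gw})♮)(b) = (M^l(U^{gw}))(b)♮` (the unguarded complex (0.4) average of UST's chart IS the tree's guarded `SU(N)` average when the loop variables stay in the guard).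
dag-n07-w2's `N07ChartLogReality.emlIterU_unitsField_eq_iter_of_reads` proves it down the reading window of a bond from FINE READS of the field.  (a) Its read hypothesis is stated
on the bonds whose SOURCE lies under the window although its proof consumes both-ends reads only; §1 re-proves it with the both-ends hypothesis (the read set of UST's
`emlIterU_congr_of_agree` ∕ `dbarIterU_congr_of_agree` and of [4] (1.18)'s block mean), byte for byte otherwise.  (b) Both sides are EXACTLY covariant under a fine gauge map read at
the block centres ([3] (11): UST `emlIterU_gaugeActT` for the left side, `B16Sect1Backgrounds.iter_gaugeAct` for the right side), so the identity for `U^u` at a bond gives the identity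
for ANY `U^{g}` at that bond (§2) — in particular for the representative `U″`, whose own fine reads the road never sees.  (c) §3 supplies the Landau copy's reads under the two blocks
of a near-class bond from the S3 door's rows (T1) (gauge equation on the tower `□₀`) and (T2) (the (152) letter `κ·ε·L^{k−j′}` under `□_{j′}`) at `j′ = j − 1`, through MODULE 78's
collar-label geometry (`L ≤ ρ`: the blocks of the collar labels of `□_j` lie under `□_{j−1} ⊆ □₀`).

WHAT IS PROVED (sorry-free; axioms standard).
* §1 ★★ `emlIterU_unitsField_eq_iter_of_reads₂` — n07-w2's dictionary with BOTH-ENDS reads (adapted from `N07ChartLogReality.emlIterU_unitsField_eq_iter_of_reads`, proof unchanged).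
* §2 ★★ `emlIterU_eq_iter_apply_of_gaugeAct` — the identity at a bond for `U^{u}` implies the identity at that bond for `U^{g}`, ANY fine `g` (covariance of both sides).
* §3 ★ `expI_eq_expCfg` (the two spellings of `e^{iηA(b)}` in the tree agree as units), ★ `mem_regionOfSet_bonds_cube_pred_of_reads` (a fine bond whose level-`j` block points are covered
  collar labels of `□_j^{(j)}` lies in `Sect2.regionOfSet (cover '' □_{j−1})`'s bonds, and in `□₀`'s), ★★ `landau_reads_of_tower` (for such bonds: `(U^u)♮(b) = e^{iηA(b)}`,
  `‖A b‖ < κ·ε·L^{k−(j−1)}`, and `‖(U^u)♮(b) − 1‖ ≤ 2·η·(κ·ε·L^{k−(j−1)})` when `η·κ·ε·L^{k−(j−1)} ≤ 1`).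
HONEST SCOPE: bookkeeping over landed theorems; (T1)∕(T2) are the S3 door's displayed rows (CONDITIONAL on `HThm4RecDbar`, N05-REC); nothing of [15]∕[3]∕[I] analysis asserted
beyond n07-w2's dictionary; (c′)‴ NOT closed here (MODULE 96); K0⁷ NOT closed; N07 NOT discharged; counts unmoved; one finite 𝕋⁴ programme at fixed ε — the route closes the conditional
finite-𝕋⁴ rung `BalabanLadder.UV` ONLY; the YM mass gap (Clay) is NOT proved by any of this; nothing continuum ∕ ℝ⁴ ∕ OS.  No `def`, no `instance`, no `notation`, no `sorry`.

References: [I] (0.4) p. 253, (0.11) p. 253, (1.10)–(1.13) p. 262; [3] (8)–(11) p. 19, (19)–(26) pp. 21–22, Prop. 4 p. 38; [15] (147) p. 301, (150)–(156) pp. 301–302;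
[6] p. 98, (1.131) p. 99; [4] (2.1)–(2.3) p. 224, [Balaban1984PropagatorsI] (1.18) p. 20.
-/

set_option autoImplicit false

noncomputable section

open scoped BigOperators Matrix.Norms.L2Operator
open NormedSpace

namespace Summit.QuantumFields.YangMills.BalabanUVNodes.N07DbarDictionaryTransfer

open Literature.MathematicalPhysics.QuantumFieldTheory.Balaban1983to89
open Literature.MathematicalPhysics.QuantumFieldTheory.Balaban1983to89.Node00
open T4Continuum BlockAveraging ExpMeanLog MatrixLog
open B10Eq27TorusAxialLog (unitsField toUField suIncl gaugeActT gaugeActT_apply val_unitsField)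
open B5Eq118OneStroke (iterBlockOf iterBlockOf_succ iterBlockOf_zero)
open B16Sect1Backgrounds (toMS iter_gaugeAct)
open B15Eq112TorusCover (cover)
open B14DomainGeom (Pt)
open B7Prop1Local (InBox)
open B8Eq131Cubes (cube sqLo sqHi cube_anti)
open B12RegularSpaces111 (gaugeU expI)
open GaugeField (gaugeAct)
open BlockAveragingEMLLinearised (length_walk)
open LatticeWordStokes (length_loopWord_le)
open Summit.QuantumFields.YangMills.Theorems.Prop8Chart
open Summit.QuantumFields.YangMills.Theorems.K0UniformFluxConfig (dist1_holAt_le_length_mul)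
open Summit.QuantumFields.YangMills.BalabanUVNodes.N07NormalisationDbarFrames (toUT unitsField_toUField_gaugeAct toUT_toMS_succ)
open Summit.QuantumFields.YangMills.BalabanUVNodes.N07FarRowsOfTowerLetters (mem_image_cover_cube_pred_of_iterBlockOf_eq)

variable {P : Params} {N : ℕ} [NeZero N]

/-! ## §1  The local dictionary with both-ends reads -/

section Dictionary

/-- ★★ **THE LOCAL DICTIONARY, BOTH-ENDS READS** (dag-n07-w2's `emlIterU_unitsField_eq_iter_of_reads` with the read hypothesis on the fine bonds whose TWO ends have their `j`-block
points among the ends of `e` — the read set of [4] (1.18) and of UST's locality lemmas; the proof is n07-w2's, unchanged): `j ≤ m + K`, `e` a `j`-bond, `0 ≤ s₀`, `6400ℓ²Lʲs₀ ≤ 1`,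
`30ℓ²Lʲs₀ < δ_N`, `‖U(b) − 1‖ ≤ s₀` on those bonds ⇒ for every `i ≤ j` and every `i`-bond `b` below `e`: `emlIterU i (U♮) b = (M^i U)♮ b` and `‖M^iU(b) − 1‖ ≤ 30ℓLⁱs₀`
(`M = Averaging.iter (blockAvg expMeanLogSU)`, the averaging of record). [cite: Balaban1987RG1, (0.4) p.253, (0.11) p.253; Balaban1985Averaging, Prop. 4 p.38; Balaban1985Variational, (152)–(156) pp.301–302] -/
theorem emlIterU_unitsField_eq_iter_of_reads₂ {j : ℕ} (hj : j ≤ P.m + P.K) (U : GaugeField P 0 (Matrix.specialUnitaryGroup (Fin N) ℂ)) (e : PBond P j)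
    {s₀ : ℝ} (hs₀ : 0 ≤ s₀) (hbudget : 6400 * (((P.d + 2) * P.L : ℕ) : ℝ) ^ 2 * (P.L : ℝ) ^ j * s₀ ≤ 1)
    (hguard : 30 * (((P.d + 2) * P.L : ℕ) : ℝ) ^ 2 * (P.L : ℝ) ^ j * s₀ < deltaSU (Fin N))
    (hU : ∀ b : PBond P 0, (iterBlockOf j b.src = e.src ∨ iterBlockOf j b.src = e.tgt) → (iterBlockOf j b.tgt = e.src ∨ iterBlockOf j b.tgt = e.tgt) →
      ‖((U b : Matrix.specialUnitaryGroup (Fin N) ℂ) : Matrix (Fin N) (Fin N) ℂ) - 1‖ ≤ s₀) :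
    ∀ i : ℕ, i ≤ j → ∀ b : PBond P i,
      (∀ x : Site P 0, iterBlockOf i x = b.src → (iterBlockOf j x = e.src ∨ iterBlockOf j x = e.tgt)) →
      (∀ x : Site P 0, iterBlockOf i x = b.tgt → (iterBlockOf j x = e.src ∨ iterBlockOf j x = e.tgt)) →
      emlIterU i (unitsField (toUField U)) b =
          unitsField (toUField (Averaging.iter (fun _ => blockAvg expMeanLogSU) i U)) b ∧
        ‖((Averaging.iter (fun _ => blockAvg expMeanLogSU) i U b : Matrix.specialUnitaryGroup (Fin N) ℂ) : Matrix (Fin N) (Fin N) ℂ) - 1‖ ≤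
          30 * (((P.d + 2) * P.L : ℕ) : ℝ) * (P.L : ℝ) ^ i * s₀ := by
  -- adapted from Summits/QuantumFields/YangMills/Theorems/BalabanUVNodesN07ChartLogReality.lean (dag-n07-w2): read hypothesis weakened to both ends
  set ℓ : ℝ := (((P.d + 2) * P.L : ℕ) : ℝ) with hℓ
  have hL1 : (1 : ℝ) ≤ P.L := by exact_mod_cast P.L_pos
  have hℓ1 : (1 : ℝ) ≤ ℓ := by
    rw [hℓ]; exact_mod_cast Nat.one_le_iff_ne_zero.mpr (Nat.mul_ne_zero (by omega) (by have := P.hL.2; omega))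
  set T : (i : ℕ) → Set (Site P i) := fun i => {y | ∀ x : Site P 0, iterBlockOf i x = y → (iterBlockOf j x = e.src ∨ iterBlockOf j x = e.tgt)} with hT
  have hTstep : ∀ (i : ℕ) (y : Site P i) (z : Site P (i + 1)), z ∈ T (i + 1) → blockOf y = z → y ∈ T i := by
    intro i y z hz hyz x hx
    exact hz x (by rw [iterBlockOf_succ, hx, hyz])
  have hnear : ∀ i : ℕ, i ≤ j → ∀ b : PBond P i, b.src ∈ T i → b.tgt ∈ T i →
      ‖((emlIterU i (unitsField (toUField U)) b : (Matrix (Fin N) (Fin N) ℂ)ˣ) : Matrix (Fin N) (Fin N) ℂ) - 1‖ ≤ 30 * ℓ * (P.L : ℝ) ^ i * s₀ := by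
    intro i hi b hs ht
    have hbud : 6400 * ℓ ^ 2 * (P.L : ℝ) ^ i * s₀ ≤ 1 := by
      have hpow : (P.L : ℝ) ^ i ≤ (P.L : ℝ) ^ j := pow_le_pow_right₀ hL1 hi
      have : 6400 * ℓ ^ 2 * (P.L : ℝ) ^ i * s₀ ≤ 6400 * ℓ ^ 2 * (P.L : ℝ) ^ j * s₀ :=
        mul_le_mul_of_nonneg_right (mul_le_mul_of_nonneg_left hpow (by positivity)) hs₀
      exact this.trans hbudget
    refine norm_emlIterU_sub_one_le_of_reads (hi.trans hj) (T i) (unitsField (toUField U)) hs₀ hbud (fun b₀ hb₀ hb₀' => ?_) b hs ht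
    rw [val_unitsField]
    exact hU b₀ (hb₀ b₀.src rfl) (hb₀' b₀.tgt rfl)
  intro i
  induction i with
  | zero =>
    intro _ b hs ht
    refine ⟨rfl, ?_⟩
    have h := hU b (hs b.src rfl) (ht b.tgt rfl)
    have h1 : s₀ ≤ 30 * ℓ * (P.L : ℝ) ^ 0 * s₀ := by rw [pow_zero, mul_one]; nlinarith
    exact h.trans h1
  | succ i ih =>
    intro hi1 c hcs hct
    have hi : i ≤ j := Nat.le_of_succ_le hi1
    have hi1' : i + 1 ≤ P.m + P.K := hi1.trans hj
    have IHw : ∀ b : PBond P i, (blockOf b.src = c.src ∨ blockOf b.src = c.tgt) → (blockOf b.tgt = c.src ∨ blockOf b.tgt = c.tgt) →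
        b.src ∈ T i ∧ b.tgt ∈ T i := by
      intro b hbs hbt
      refine ⟨?_, ?_⟩
      · rcases hbs with h | h
        · exact hTstep i b.src c.src hcs h
        · exact hTstep i b.src c.tgt hct h
      · rcases hbt with h | h
        · exact hTstep i b.tgt c.src hcs h
        · exact hTstep i b.tgt c.tgt hct h
    have heq : ∀ b : PBond P i, (blockOf b.src = c.src ∨ blockOf b.src = c.tgt) → (blockOf b.tgt = c.src ∨ blockOf b.tgt = c.tgt) →
        emlIterU i (unitsField (toUField U)) b = unitsField (toUField (Averaging.iter (fun _ => blockAvg expMeanLogSU) i U)) b :=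
      fun b hbs hbt => (ih hi b (IHw b hbs hbt).1 (IHw b hbs hbt).2).1
    have hsmall : Small (expMeanLogSU (n := Fin N)) (Averaging.iter (fun _ => blockAvg expMeanLogSU) i U) c := by
      intro idx
      show dist1 (holAt (Averaging.iter (fun _ => blockAvg expMeanLogSU) i U) (walk (emb c.src) (loopWord P.L c.dir (off idx.1) idx.2.1 idx.2.2))) <
        (expMeanLogSU (n := Fin N)).δ
      rw [expMeanLogSU_δ]
      have hsteps : ∀ s ∈ walk (emb c.src) (loopWord P.L c.dir (off idx.1) idx.2.1 idx.2.2),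
          dist1 (Averaging.iter (fun _ => blockAvg expMeanLogSU) i U s.bond) ≤ 30 * ℓ * (P.L : ℝ) ^ i * s₀ := by
        intro s hs
        have hbs := blockOf_src_of_mem_walk hi1' c idx s hs
        have hbt := T4ReflectionConeSharp.blockOf_tgt_of_mem_walk hi1' c idx s hs
        obtain ⟨hsT, htT⟩ := IHw s.bond hbs hbt
        have h := hnear i hi s.bond hsT htT
        rw [heq s.bond hbs hbt, val_unitsField] at h
        exact h
      have hlen : ((walk (emb c.src) (loopWord P.L c.dir (off idx.1) idx.2.1 idx.2.2)).length : ℝ) ≤ ℓ := by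
        rw [length_walk, hℓ]
        exact_mod_cast length_loopWord_le c idx
      have hpow : (P.L : ℝ) ^ i ≤ (P.L : ℝ) ^ j := pow_le_pow_right₀ hL1 hi
      calc dist1 (holAt (Averaging.iter (fun _ => blockAvg expMeanLogSU) i U) (walk (emb c.src) (loopWord P.L c.dir (off idx.1) idx.2.1 idx.2.2)))
          ≤ ((walk (emb c.src) (loopWord P.L c.dir (off idx.1) idx.2.1 idx.2.2)).length : ℝ) * (30 * ℓ * (P.L : ℝ) ^ i * s₀) :=
            dist1_holAt_le_length_mul _ _ hsteps
        _ ≤ ℓ * (30 * ℓ * (P.L : ℝ) ^ j * s₀) := by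
            refine mul_le_mul hlen (mul_le_mul_of_nonneg_right (mul_le_mul_of_nonneg_left hpow (by positivity)) hs₀) (by positivity) (by positivity)
        _ = 30 * ℓ ^ 2 * (P.L : ℝ) ^ j * s₀ := by ring
        _ < deltaSU (Fin N) := hguard
        _ = min (1 / 3) (Real.pi / Fintype.card (Fin N)) := rfl
    have hstep : emlIterU (i + 1) (unitsField (toUField U)) c =
        unitsField (toUField (Averaging.iter (fun _ => blockAvg expMeanLogSU) (i + 1) U)) c := by
      rw [emlIterU_succ, emlAvgU_congr₂ hi1' c heq]
      apply Units.ext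
      rw [coe_emlAvgU_unitsField _ c hsmall, val_unitsField]
      rfl
    refine ⟨hstep, ?_⟩
    have h := hnear (i + 1) hi1 c hcs hct
    rw [hstep, val_unitsField] at h
    exact h

end Dictionary

/-! ## §2  The identity transfers between gauge copies -/

section Transfer

/-- ★★ **THE DICTIONARY IDENTITY IS GAUGE COVARIANT**: if `Ū^{(i)}_{eml}((U^{u})♮)(b) = (M^i(U^{u}))(b)♮` at a bond `b` of level `i ≤ m + K`, then for EVERY fine gauge map `g`,
`Ū^{(i)}_{eml}((U^{g})♮)(b) = (M^i(U^{g}))(b)♮` — both sides transform by the SAME centre-read gauge map `(g·u⁻¹)↾T^{(i)}` ([3] (11): UST `emlIterU_gaugeActT`, `iter_gaugeAct`,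
`unitsField_toUField_gaugeAct`; `U^{g} = (U^{u})^{g·u⁻¹}`).  Any `Averaging` structure `av`. [cite: Balaban1985Averaging, (8) p.19, (11) p.19; Balaban1987RG1, (0.11) p.253] -/
theorem emlIterU_eq_iter_apply_of_gaugeAct (av : ∀ i, Averaging P i (SU N)) {i : ℕ} (hi : i ≤ P.m + P.K) (U : GaugeField P 0 (SU N)) (u g : GaugeTransf P 0 (SU N))
    (b : PBond P i)
    (h : emlIterU i (unitsField (toUField (gaugeAct u U))) b = unitsField (toUField (Averaging.iter av i (gaugeAct u U))) b) :
    emlIterU i (unitsField (toUField (gaugeAct g U))) b = unitsField (toUField (Averaging.iter av i (gaugeAct g U))) b := by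
  -- `U^{g} = (U^{u})^{g u⁻¹}`
  set q : GaugeTransf P 0 (SU N) := fun x => g x * (u x)⁻¹ with hq
  have hgu : gaugeAct g U = gaugeAct q (gaugeAct u U) := by
    rw [T3UnitLawGaugeInvariance.gaugeAct_gaugeAct]
    congr 1
    funext x
    rw [hq]
    simp
  have hUq : unitsField (toUField (gaugeAct q (gaugeAct u U))) = gaugeActT (toUT (toMS q 0)) (unitsField (toUField (gaugeAct u U))) :=
    unitsField_toUField_gaugeAct q _
  rw [hgu, hUq, emlIterU_gaugeActT (fun i => toUT (toMS q i)) (fun i y => toUT_toMS_succ q i y) _ i,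
    iter_gaugeAct av q (gaugeAct u U) i hi, unitsField_toUField_gaugeAct (toMS q i)]
  rw [gaugeActT_apply, gaugeActT_apply, h]

end Transfer

/-! ## §3  The Landau copy's reads under the blocks of a near-class bond, from the S3 door's rows (T1)∕(T2) -/

section Reads

omit [NeZero N] in
/-- ★ The two spellings of the charted bond variable agree: `B12RegularSpaces111.expI η (A b) = Prop8Chart.expCfg η A b` (both the unit `e^{iηA(b)}` of `M_N(ℂ)`).
[cite: Balaban1985Variational, (152) p.301; Balaban1987RG1, (1.13) p.262] -/
theorem expI_eq_expCfg (η : ℝ) (A : PBond P 0 → MatA N) (b : PBond P 0) : expI η (A b) = expCfg η A b := by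
  apply Units.ext
  rw [B12Lemma4Concrete.val_expI, coe_expCfg]

omit [NeZero N] in
/-- ★ **A FINE BOND UNDER THE COLLAR LABELS OF `□_j^{(j)}` LIES UNDER `□_{j−1}` AND UNDER `□₀`**: if both `j`-block points of the fine bond `b` are `π_j s`, `π_j s′` for collar labels
`s, s′ ∈ [sqLo_j − 1, sqHi_j + 1]` (`1 ≤ j ≤ k`, `L ≤ ρ`), then `b ∈ (Sect2.regionOfSet (cover '' □_{j−1})).bonds ⊆ (Sect2.regionOfSet (cover '' □₀)).bonds` (MODULE 78's
`mem_image_cover_cube_pred_of_iterBlockOf_eq` at both ends; [6] p. 98's collar `ρ ≥ L` blocks). [cite: Balaban1985RegularSpaces, p.98, (1.131) p.99; Balaban1984PropagatorsII, (2.3) p.224] -/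
theorem mem_regionOfSet_bonds_cube_pred_of_reads {a : Pt P.d} {M ρ k j : ℕ} (hj : j ≤ P.m + P.K) (hLρ : P.L ≤ ρ) (h1 : 1 ≤ j) (hjk : j ≤ k)
    {s s' : Pt P.d} (hs : InBox (sqLo P.L a ρ k j - 1) (sqHi P.L a M ρ k j + 1) s) (hs' : InBox (sqLo P.L a ρ k j - 1) (sqHi P.L a M ρ k j + 1) s')
    (b : PBond P 0) (hsrc : iterBlockOf j b.src = coverAt P j s ∨ iterBlockOf j b.src = coverAt P j s')
    (htgt : iterBlockOf j b.tgt = coverAt P j s ∨ iterBlockOf j b.tgt = coverAt P j s') :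
    b ∈ (Sect2.regionOfSet P (cover P '' cube P.L a M ρ k (j - 1))).bonds ∧ b ∈ (Sect2.regionOfSet P (cover P '' cube P.L a M ρ k 0)).bonds := by
  have hmem : ∀ x : Site P 0, (iterBlockOf j x = coverAt P j s ∨ iterBlockOf j x = coverAt P j s') → x ∈ cover P '' cube P.L a M ρ k (j - 1) := by
    intro x hx
    rcases hx with h | h
    · exact mem_image_cover_cube_pred_of_iterBlockOf_eq hj hLρ h1 hjk hs h
    · exact mem_image_cover_cube_pred_of_iterBlockOf_eq hj hLρ h1 hjk hs' h
  have h1' : b ∈ (Sect2.regionOfSet P (cover P '' cube P.L a M ρ k (j - 1))).bonds := ⟨hmem b.src hsrc, hmem b.tgt htgt⟩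
  exact ⟨h1', Sect2.regionOfSet_bonds_mono (Set.image_mono (cube_anti (Nat.zero_le _) (by omega))) h1'⟩

/-- ★★ **THE LANDAU COPY's READS UNDER A NEAR-CLASS BOND** — from the S3 door's rows: (T1) the gauge equation `U^u = e^{iηA}` on the fine bonds under the tower's bottom cube `□₀`, (T2) the
(152) letter `‖A b‖ < κ·ε·L^{k−j′}` under `□_{j′}` for every `j′ ≤ k`.  For a fine bond `b` whose two `j`-block points are covered collar labels of `□_j^{(j)}` (`1 ≤ j ≤ k`, `L ≤ ρ`):
`(U^u)♮(b) = expCfg η A b`, `‖A b‖ < κ·ε·L^{k−(j−1)}`, and — if `η·(κ·ε·L^{k−(j−1)}) ≤ 1` — `‖(U^u)♮(b) − 1‖ ≤ 2·η·(κ·ε·L^{k−(j−1)})`.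
[cite: Balaban1985Variational, (147) p.301, (152)–(153) p.301; Balaban1987RG1, (1.12)–(1.13) p.262; Balaban1985RegularSpaces, p.98, (1.131) p.99] -/
theorem landau_reads_of_tower {a : Pt P.d} {M ρ k j : ℕ} (hj : j ≤ P.m + P.K) (hLρ : P.L ≤ ρ) (h1 : 1 ≤ j) (hjk : j ≤ k)
    (U : GaugeField P 0 (SU N)) (u : GaugeTransf P 0 (SU N)) (A : PBond P 0 → MatA N) {η κ ε : ℝ} (hη : 0 ≤ η)
    (hT1 : ∀ b ∈ (Sect2.regionOfSet P (cover P '' cube P.L a M ρ k 0)).bonds, gaugeU (fun x => ιSU N (u x)) (fun b' => ιSU N (U b')) b = expI η (A b))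
    (hT2 : ∀ j', j' ≤ k → ∀ b ∈ (Sect2.regionOfSet P (cover P '' cube P.L a M ρ k j')).bonds, ‖A b‖ < κ * ε * (P.L : ℝ) ^ (k - j'))
    {s s' : Pt P.d} (hs : InBox (sqLo P.L a ρ k j - 1) (sqHi P.L a M ρ k j + 1) s) (hs' : InBox (sqLo P.L a ρ k j - 1) (sqHi P.L a M ρ k j + 1) s')
    (b : PBond P 0) (hsrc : iterBlockOf j b.src = coverAt P j s ∨ iterBlockOf j b.src = coverAt P j s')
    (htgt : iterBlockOf j b.tgt = coverAt P j s ∨ iterBlockOf j b.tgt = coverAt P j s') :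
    unitsField (toUField (gaugeAct u U)) b = expCfg η A b ∧ ‖A b‖ < κ * ε * (P.L : ℝ) ^ (k - (j - 1)) ∧
      (η * (κ * ε * (P.L : ℝ) ^ (k - (j - 1))) ≤ 1 →
        ‖((unitsField (toUField (gaugeAct u U)) b : (MatA N)ˣ) : MatA N) - 1‖ ≤ 2 * (η * (κ * ε * (P.L : ℝ) ^ (k - (j - 1))))) := by
  obtain ⟨hb1, hb0⟩ := mem_regionOfSet_bonds_cube_pred_of_reads hj hLρ h1 hjk hs hs' b hsrc htgt
  have heq : unitsField (toUField (gaugeAct u U)) b = expCfg η A b := by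
    have h := hT1 b hb0
    rw [gaugeU_ιSU, expI_eq_expCfg] at h
    apply Units.ext
    rw [val_unitsField, ← h]
    rfl
  have hA : ‖A b‖ < κ * ε * (P.L : ℝ) ^ (k - (j - 1)) := hT2 (j - 1) (by omega) b hb1
  refine ⟨heq, hA, fun hsmall => ?_⟩
  rw [heq]
  have hnorm : ‖(η : ℂ) • A b‖ = η * ‖A b‖ := by rw [norm_smul, Complex.norm_real, Real.norm_of_nonneg hη]
  have hle : ‖(η : ℂ) • A b‖ ≤ η * (κ * ε * (P.L : ℝ) ^ (k - (j - 1))) := by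
    rw [hnorm]; exact mul_le_mul_of_nonneg_left hA.le hη
  exact (norm_coe_expCfg_sub_one_le η A b (hle.trans hsmall)).trans (by linarith)

end Reads

end Summit.QuantumFields.YangMills.BalabanUVNodes.N07DbarDictionaryTransfer

end
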